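import Summits.HodgeConjecture.HodgeConjecture.Theorems.CYFormCasimirCYFormSquarePrincipleCoord
import HarnessLib

/-!
# Crux X3 `CYFormSquarePrinciple` (route `CYFormCasimir`, stmt-HodgeConjecture-23494), helper file 3:
# uniqueness of `SU_H`-invariant bilinear forms on `⋀^qW^*` (the "(Sym² ⋀⁴)^{SL₈} = ℂ" input of the
# Casimir principle, by the tree's torus / signed-transposition method)

research route conditional on HC_CM; not a corollary. Nothing here proves HC, HC_CM or any rung.

In the Weil basis `w, w^*` of `H¹(A(ℂ); ℂ) = W ⊕ W^*` (`VanGeemen1994.weilBasis`, block size `k`) let `b_s`,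
`s ⊆ Fin (k + k)`, `#s = q`, be the monomial basis of `H^q` and `b_J⁻ := b_{natAdd(J)}` (`J ⊆ Fin k`, `#J = q`)
the monomials in the `w^*`'s, a basis of `⋀^qW^*`. Let `E` be a bilinear form on `H^q(A(ℂ); ℂ)` invariant
under the exterior action of the diagonal torus elements `torusAuto` and of the signed transpositions
`swapAuto` of `SU_H(ℂ)` (van Geemen, LNM 1594, proof of Thm. 6.12). THEN (for `q + q = k`, `q > 0`):

* `bilin_natAdd_eq_zero_of_ne_compl` — `E(b_J⁻, b_{J'}⁻) = 0` unless `J' = Jᶜ` (a torus element has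
  weight `≠ 1` on the pair);
* `bilin_natAdd_compl_eq_zero_of_eq_zero` — if `E(b_{J₀}⁻, b_{J₀ᶜ}⁻) = 0` for ONE `J₀` then
  `E(b_J⁻, b_{Jᶜ}⁻) = 0` for all `J` (the signed transpositions act transitively on the `q`-subsets);
* `bilin_natAdd_eq_zero` — hence such an `E` vanishing at one complementary pair vanishes on all pairs
  `(b_J⁻, b_{J'}⁻)`: the space of invariant bilinear forms on `⋀^qW^*` is at most a line
  (classically: `(⋀^qW^* ⊗ ⋀^qW^*)^{SL(W)} = ℂ` for `2q = dim W`).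

This is the bilinear analogue of the tree's `VanGeemen1994.eq_zero_of_invariant`. Also recorded here (moved
from helper file 2 for size): `dim ⋀⁴W, dim ⋀⁴W^* ≤ 70` for an eightfold.

References: vanGeemen1994HodgeAV (Lemma 6.10, proof of Thm. 6.12), FultonHarris1991 ((6.9), Thm. 6.3 — the
classical statement; not used).
-/

-- `Summit.HodgeConjecture.HodgeConjecture.…` is the tree's mandated summit/problem namespace (single-problem summit).
set_option linter.dupNamespace false
noncomputable section

open CategoryTheory
open Literature.AlgebraicTopology.SingularHomology
open Literature.AlgebraicGeometry.Motives
open Literature.AlgebraicGeometry.HodgeTheory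
open Literature.AlgebraicGeometry.VanGeemen1994

namespace Summit.HodgeConjecture.HodgeConjecture.Theorems.CYFormSquare

/-! ### `dim ⋀⁴W ≤ 70`, `dim ⋀⁴W^* ≤ 70` for an eightfold -/

/-- `#{4-subsets of Fin 8} = 70`. [folklore] -/
theorem card_powersetCard_fin_eight_four : Fintype.card (Set.powersetCard (Fin (2 * 4)) (2 * 2)) = 70 := by
  rw [← Nat.card_eq_fintype_card, Set.powersetCard.card, Nat.card_eq_fintype_card, Fintype.card_fin]
  decide

section Eightfold

variable {A : AbelianVariety ℂ} {d : ℕ} {φ : A ⟶ A}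
variable (hn : 2 ≤ 4) (hd : 0 < d) (hA : A.dim = 2 * 4) (hφ : φ ≫ φ = -(d • 𝟙 A))
  (e : ProjectiveEmbedding A.X) {a : complexBetti (projectiveSpace e.n ℂ) 2} (ha : IsRationalClass a)
  (ha0 : a ≠ 0)

include hn hd hA hφ e ha ha0 in
/-- **`dim ⋀⁴W ≤ 70`** for an eightfold: `E₊⁽⁴⁾` is spanned by the `C(8,4) = 70` monomials `b_{castAdd(I)}`.
[cite: vanGeemen1994HodgeAV, proof of Thm. 6.12] -/
theorem finrank_weilClassesPlus_two_le : Module.finrank ℂ (weilClassesPlus A φ 2 d) ≤ 70 := by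
  haveI := finite_complexBetti_abelianVariety A (2 * 2)
  calc Module.finrank ℂ (weilClassesPlus A φ 2 d)
      ≤ Module.finrank ℂ (Submodule.span ℂ (Set.range fun I : Set.powersetCard (Fin (2 * 4)) (2 * 2) ↦
          monB (bW hn hd hA hφ e ha ha0) (2 * 2) (Set.powersetCard.map (2 * 2) (Fin.castAddEmb (2 * 4)) I))) :=
        Submodule.finrank_mono (weilClassesPlus_two_le_span hn hd hA hφ e ha ha0)
    _ ≤ Fintype.card (Set.powersetCard (Fin (2 * 4)) (2 * 2)) := finrank_range_le_card _
    _ = 70 := card_powersetCard_fin_eight_four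

include hn hd hA hφ e ha ha0 in
/-- **`dim ⋀⁴W^* ≤ 70`** for an eightfold. [cite: vanGeemen1994HodgeAV, proof of Thm. 6.12] -/
theorem finrank_weilClassesMinus_two_le : Module.finrank ℂ (weilClassesMinus A φ 2 d) ≤ 70 := by
  haveI := finite_complexBetti_abelianVariety A (2 * 2)
  calc Module.finrank ℂ (weilClassesMinus A φ 2 d)
      ≤ Module.finrank ℂ (Submodule.span ℂ (Set.range fun J : Set.powersetCard (Fin (2 * 4)) (2 * 2) ↦
          monB (bW hn hd hA hφ e ha ha0) (2 * 2) (Set.powersetCard.map (2 * 2) (Fin.natAddEmb (2 * 4)) J))) :=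
        Submodule.finrank_mono (weilClassesMinus_two_le_span hn hd hA hφ e ha ha0)
    _ ≤ Fintype.card (Set.powersetCard (Fin (2 * 4)) (2 * 2)) := finrank_range_le_card _
    _ = 70 := card_powersetCard_fin_eight_four

end Eightfold

/-! ### Index combinatorics of the block permutation and the torus weights -/

section Combinatorics

variable {k : ℕ}

/-- `(σ ⊕ σ)(natAdd j) = natAdd (σ j)` (the tree's lemma is private). [folklore] -/
theorem blockPerm_natAdd' (σ : Equiv.Perm (Fin k)) (j : Fin k) :
    blockPerm σ (Fin.natAdd k j) = Fin.natAdd k (σ j) := by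
  rw [blockPerm, Equiv.permCongr_apply, finSumFinEquiv_symm_apply_natAdd, Equiv.sumCongr_apply, Sum.map_inr,
    finSumFinEquiv_apply_right]

/-- The block permutation of a `w^*`-monomial index set: `(σ ⊕ σ)(natAdd(J)) = natAdd(σ J)`. [folklore] -/
theorem permSet_blockPerm_map_natAddEmb (σ : Equiv.Perm (Fin k)) {q : ℕ} (J : Set.powersetCard (Fin k) q) :
    permSet (blockPerm σ) (Set.powersetCard.map q (Fin.natAddEmb k) J) =
      Set.powersetCard.map q (Fin.natAddEmb k) (Set.powersetCard.map q σ.toEmbedding J) := by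
  apply Subtype.ext
  change (Set.powersetCard.map q (Fin.natAddEmb k) J).val.map (blockPerm σ).toEmbedding = _
  rw [Set.powersetCard.val_map, Set.powersetCard.val_map, Set.powersetCard.val_map, Finset.map_map, Finset.map_map]
  congr 1
  exact Function.Embedding.ext fun j ↦ blockPerm_natAdd' σ j

/-- The torus unit on a second-block index is the inverse weight (the tree's lemma is private). [folklore] -/
theorem torusUnits_natAdd' (i₀ i₁ i : Fin k) : torusUnits i₀ i₁ (Fin.natAdd k i) = (torusWt i₀ i₁ i)⁻¹ := by
  rw [torusUnits, Fin.append_right]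

/-- The inverse torus weights: `2⁻¹` at `i₀`, `2` at `i₁`, `1` elsewhere (`i₀ ≠ i₁`). [folklore] -/
theorem coe_torusWt_inv (i₀ i₁ : Fin k) (hne : i₀ ≠ i₁) (j : Fin k) :
    (((torusWt i₀ i₁ j)⁻¹ : ℂˣ) : ℂ) = if j = i₀ then 2⁻¹ else if j = i₁ then 2 else 1 := by
  unfold torusWt
  by_cases h1 : j = i₁
  · subst h1
    rw [Function.update_self, inv_inv, if_neg (Ne.symm hne), if_pos rfl]; rfl
  · rw [Function.update_of_ne h1]
    by_cases h0 : j = i₀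
    · subst h0
      rw [Function.update_self, if_pos rfl, Units.val_inv_eq_inv_val]; rfl
    · rw [Function.update_of_ne h0, if_neg h0, if_neg h1, inv_one, Units.val_one]

/-- **Torus weight of a `w^*`-monomial**: `2^{-[i₀ ∈ J]} · 2^{[i₁ ∈ J]}`. [cite: vanGeemen1994HodgeAV, proof of Thm. 6.12] -/
theorem torusWeight_map_natAddEmb {q : ℕ} (i₀ i₁ : Fin k) (hne : i₀ ≠ i₁) (J : Set.powersetCard (Fin k) q) :
    torusWeight i₀ i₁ (Set.powersetCard.map q (Fin.natAddEmb k) J).val =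
      (if i₀ ∈ J.val then (2 : ℂ)⁻¹ else 1) * (if i₁ ∈ J.val then (2 : ℂ) else 1) := by
  classical
  rw [torusWeight, Set.powersetCard.val_map, Finset.prod_map]
  have h : ∀ j ∈ J.val, ((torusUnits i₀ i₁ (Fin.natAddEmb k j) : ℂˣ) : ℂ) =
      (if j = i₀ then (2 : ℂ)⁻¹ else 1) * (if j = i₁ then (2 : ℂ) else 1) := by
    intro j _
    change ((torusUnits i₀ i₁ (Fin.natAdd k j) : ℂˣ) : ℂ) = _
    rw [torusUnits_natAdd', coe_torusWt_inv i₀ i₁ hne]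
    by_cases h0 : j = i₀
    · subst h0; rw [if_pos rfl, if_pos rfl, if_neg hne, mul_one]
    · rw [if_neg h0, if_neg h0, one_mul]
  rw [Finset.prod_congr rfl h, Finset.prod_mul_distrib, Finset.prod_ite_eq', Finset.prod_ite_eq']

/-- **Torus weights detect the non-complementary pairs**: for `q`-subsets `J, J'` of `Fin k`, `q + q = k`,
`q > 0`, with `J' ≠ Jᶜ` there is a torus element whose weights on `b_J⁻`, `b_{J'}⁻` do not multiply to `1`.
[cite: vanGeemen1994HodgeAV, proof of Thm. 6.12] -/
theorem exists_torusWeight_mul_ne_one {q : ℕ} (hqk : q + q = k) (hq : 0 < q) (J J' : Set.powersetCard (Fin k) q)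
    (hJ : J'.val ≠ J.valᶜ) :
    ∃ i₀ i₁ : Fin k, i₀ ≠ i₁ ∧
      torusWeight i₀ i₁ (Set.powersetCard.map q (Fin.natAddEmb k) J).val *
        torusWeight i₀ i₁ (Set.powersetCard.map q (Fin.natAddEmb k) J').val ≠ 1 := by
  classical
  -- an index where the two membership bits agree
  have hex : ∃ i, (i ∈ J.val ∧ i ∈ J'.val) ∨ (i ∉ J.val ∧ i ∉ J'.val) := by
    by_contra h
    simp only [not_exists, not_or, not_and, not_not] at h
    apply hJ
    ext i
    rw [Finset.mem_compl]
    exact ⟨fun hi' hi ↦ (h i).1 hi hi', fun hi ↦ (h i).2 hi⟩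
  obtain ⟨i, hi⟩ := hex
  rcases hi with ⟨hiJ, hiJ'⟩ | ⟨hiJ, hiJ'⟩
  · -- some index is not in both (`#J = q < k`)
    have hex' : ∃ i', ¬(i' ∈ J.val ∧ i' ∈ J'.val) := by
      by_contra h
      simp only [not_exists, not_not] at h
      have hJu : J.val = Finset.univ := Finset.eq_univ_of_forall fun x ↦ (h x).1
      have hc := J.prop
      rw [Set.powersetCard.mem_iff] at hc
      rw [hJu, Finset.card_univ, Fintype.card_fin] at hc
      omega
    obtain ⟨i', hi'⟩ := hex'
    have hne : i ≠ i' := fun h ↦ hi' (h ▸ ⟨hiJ, hiJ'⟩)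
    refine ⟨i, i', hne, ?_⟩
    rw [torusWeight_map_natAddEmb i i' hne J, torusWeight_map_natAddEmb i i' hne J', if_pos hiJ, if_pos hiJ']
    by_cases h1 : i' ∈ J.val
    · have h2 : i' ∉ J'.val := fun h ↦ hi' ⟨h1, h⟩
      rw [if_pos h1, if_neg h2]; norm_num
    · by_cases h2 : i' ∈ J'.val
      · rw [if_neg h1, if_pos h2]; norm_num
      · rw [if_neg h1, if_neg h2]; norm_num
  · -- some index lies in `J` (`q > 0`)
    have hex' : ∃ i', i' ∈ J.val := by
      have hc := J.prop
      rw [Set.powersetCard.mem_iff] at hc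
      exact Finset.card_pos.1 (by omega)
    obtain ⟨i', hi'⟩ := hex'
    have hne : i' ≠ i := fun h ↦ hiJ (h ▸ hi')
    refine ⟨i', i, hne, ?_⟩
    rw [torusWeight_map_natAddEmb i' i hne J, torusWeight_map_natAddEmb i' i hne J', if_pos hi', if_neg hiJ,
      if_neg hiJ']
    by_cases h2 : i' ∈ J'.val
    · rw [if_pos h2]; norm_num
    · rw [if_neg h2]; norm_num

end Combinatorics

/-! ### Invariant bilinear forms on `⋀^qW^*` -/

section Invariant

variable {m d k : ℕ} {A : AbelianVariety ℂ}
variable (hm : 1 ≤ m) (hA : A.dim = m + 1) (hd : 0 < d) {φ : A ⟶ A} (hφ : φ ≫ φ = -(d • 𝟙 A))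
  (e : ProjectiveEmbedding A.X) {a : complexBetti (projectiveSpace e.n ℂ) 2} (ha : IsRationalClass a)
  (ha0 : a ≠ 0) (w : Module.Basis (Fin k) ℂ (eigW A φ d)) {q : ℕ}
  (E : complexBetti A.X q →ₗ[ℂ] complexBetti A.X q →ₗ[ℂ] ℂ)

/-- **Torus invariance kills the non-complementary pairs**: if `E` is invariant under the exterior action of the
torus elements then `E(b_J⁻, b_{J'}⁻) = 0` for `J' ≠ Jᶜ` (`q + q = k`, `q > 0`). [cite: vanGeemen1994HodgeAV, proof of Thm. 6.12] -/
theorem bilin_natAdd_eq_zero_of_ne_compl (hqk : q + q = k) (hq : 0 < q)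
    (hT : ∀ i₀ i₁ : Fin k, i₀ ≠ i₁ → ∀ x y : complexBetti A.X q,
      E (extAct (torusAuto hm hA hd hφ e ha ha0 w i₀ i₁ : complexBetti A.X 1 →ₗ[ℂ] complexBetti A.X 1) q x)
        (extAct (torusAuto hm hA hd hφ e ha ha0 w i₀ i₁ : complexBetti A.X 1 →ₗ[ℂ] complexBetti A.X 1) q y) = E x y)
    (J J' : Set.powersetCard (Fin k) q) (hJ : J'.val ≠ J.valᶜ) :
    E (monB (weilBasis hm hA hd hφ e ha ha0 w) q (Set.powersetCard.map q (Fin.natAddEmb k) J))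
      (monB (weilBasis hm hA hd hφ e ha ha0 w) q (Set.powersetCard.map q (Fin.natAddEmb k) J')) = 0 := by
  obtain ⟨i₀, i₁, hne, hw⟩ := exists_torusWeight_mul_ne_one hqk hq J J' hJ
  have h := hT i₀ i₁ hne (monB (weilBasis hm hA hd hφ e ha ha0 w) q (Set.powersetCard.map q (Fin.natAddEmb k) J))
    (monB (weilBasis hm hA hd hφ e ha ha0 w) q (Set.powersetCard.map q (Fin.natAddEmb k) J'))
  rw [extAct_torusAuto_monB, extAct_torusAuto_monB, LinearMap.map_smul₂, map_smul, smul_eq_mul, smul_eq_mul,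
    ← mul_assoc] at h
  have h' : (torusWeight i₀ i₁ (Set.powersetCard.map q (Fin.natAddEmb k) J).val *
      torusWeight i₀ i₁ (Set.powersetCard.map q (Fin.natAddEmb k) J').val - 1) *
      E (monB (weilBasis hm hA hd hφ e ha ha0 w) q (Set.powersetCard.map q (Fin.natAddEmb k) J))
        (monB (weilBasis hm hA hd hφ e ha ha0 w) q (Set.powersetCard.map q (Fin.natAddEmb k) J')) = 0 := by
    rw [sub_mul, one_mul, h, sub_self]
  exact (mul_eq_zero.1 h').resolve_left (sub_ne_zero.2 hw)

/-- **Transport along a signed transposition**: if `E` is invariant under the exterior action of `swapAuto x y`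
then `E(b_J⁻, b_{J'}⁻) = 0` implies the same for the transposed pair `(τJ, τJ')`, `τ = (x y)`.
[cite: vanGeemen1994HodgeAV, proof of Thm. 6.12] -/
theorem bilin_natAdd_swap_eq_zero {x y : Fin k}
    (hS : ∀ u v : complexBetti A.X q,
      E (extAct (swapAuto hm hA hd hφ e ha ha0 w x y : complexBetti A.X 1 →ₗ[ℂ] complexBetti A.X 1) q u)
        (extAct (swapAuto hm hA hd hφ e ha ha0 w x y : complexBetti A.X 1 →ₗ[ℂ] complexBetti A.X 1) q v) = E u v)
    (J J' : Set.powersetCard (Fin k) q)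
    (h0 : E (monB (weilBasis hm hA hd hφ e ha ha0 w) q (Set.powersetCard.map q (Fin.natAddEmb k) J))
      (monB (weilBasis hm hA hd hφ e ha ha0 w) q (Set.powersetCard.map q (Fin.natAddEmb k) J')) = 0) :
    E (monB (weilBasis hm hA hd hφ e ha ha0 w) q
        (Set.powersetCard.map q (Fin.natAddEmb k) (Set.powersetCard.map q (Equiv.swap x y).toEmbedding J)))
      (monB (weilBasis hm hA hd hφ e ha ha0 w) q
        (Set.powersetCard.map q (Fin.natAddEmb k) (Set.powersetCard.map q (Equiv.swap x y).toEmbedding J'))) = 0 := by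
  obtain ⟨ε, hε, hεJ⟩ := extAct_swapAuto_monB hm hA hd hφ e ha ha0 w x y q (Set.powersetCard.map q (Fin.natAddEmb k) J)
  obtain ⟨ε', hε', hεJ'⟩ := extAct_swapAuto_monB hm hA hd hφ e ha ha0 w x y q (Set.powersetCard.map q (Fin.natAddEmb k) J')
  have h := hS (monB (weilBasis hm hA hd hφ e ha ha0 w) q (Set.powersetCard.map q (Fin.natAddEmb k) J))
    (monB (weilBasis hm hA hd hφ e ha ha0 w) q (Set.powersetCard.map q (Fin.natAddEmb k) J'))
  rw [hεJ, hεJ', permSet_blockPerm_map_natAddEmb, permSet_blockPerm_map_natAddEmb, LinearMap.map_smul₂, map_smul,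
    smul_eq_mul, smul_eq_mul, ← mul_assoc, h0] at h
  exact (mul_eq_zero.1 h).resolve_left (mul_ne_zero hε hε')

/-- **The signed transpositions act transitively on the complementary pairs**: if `E` is swap-invariant and
`E(b_{J₀}⁻, b_{J₀ᶜ}⁻) = 0` for one `q`-subset `J₀` then `E(b_J⁻, b_{Jᶜ}⁻) = 0` for every `q`-subset `J`
(induction on `#(J ∖ J₀)`, as in the tree's `VanGeemen1994.eq_zero_of_invariant`). [cite: vanGeemen1994HodgeAV, proof of Thm. 6.12] -/
theorem bilin_natAdd_compl_eq_zero_of_eq_zero (hqk : q + q = Fintype.card (Fin k))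
    (hS : ∀ x y : Fin k, x ≠ y → ∀ u v : complexBetti A.X q,
      E (extAct (swapAuto hm hA hd hφ e ha ha0 w x y : complexBetti A.X 1 →ₗ[ℂ] complexBetti A.X 1) q u)
        (extAct (swapAuto hm hA hd hφ e ha ha0 w x y : complexBetti A.X 1 →ₗ[ℂ] complexBetti A.X 1) q v) = E u v)
    (J₀ : Set.powersetCard (Fin k) q)
    (h0 : E (monB (weilBasis hm hA hd hφ e ha ha0 w) q (Set.powersetCard.map q (Fin.natAddEmb k) J₀))
      (monB (weilBasis hm hA hd hφ e ha ha0 w) q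
        (Set.powersetCard.map q (Fin.natAddEmb k) (Set.powersetCard.compl hqk J₀))) = 0)
    (J : Set.powersetCard (Fin k) q) :
    E (monB (weilBasis hm hA hd hφ e ha ha0 w) q (Set.powersetCard.map q (Fin.natAddEmb k) J))
      (monB (weilBasis hm hA hd hφ e ha ha0 w) q
        (Set.powersetCard.map q (Fin.natAddEmb k) (Set.powersetCard.compl hqk J))) = 0 := by
  classical
  -- induction on the distance `#(J ∖ J₀)`
  suffices H : ∀ r : ℕ, ∀ J : Set.powersetCard (Fin k) q, (J.val \ J₀.val).card = r →
      E (monB (weilBasis hm hA hd hφ e ha ha0 w) q (Set.powersetCard.map q (Fin.natAddEmb k) J))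
        (monB (weilBasis hm hA hd hφ e ha ha0 w) q
          (Set.powersetCard.map q (Fin.natAddEmb k) (Set.powersetCard.compl hqk J))) = 0 from H _ J rfl
  intro r
  induction r with
  | zero =>
    intro J hr
    have hsub : J.val ⊆ J₀.val := Finset.sdiff_eq_empty_iff_subset.1 (Finset.card_eq_zero.1 hr)
    have hcard : J.val.card = J₀.val.card := by rw [J.prop, J₀.prop]
    have hJJ : J = J₀ := Subtype.ext (Finset.eq_of_subset_of_card_le hsub hcard.ge)
    rw [hJJ]; exact h0
  | succ r ih =>
    intro J hr
    obtain ⟨y, hy⟩ : (J.val \ J₀.val).Nonempty := Finset.card_pos.1 (by omega)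
    have hcard : J.val.card = J₀.val.card := by rw [J.prop, J₀.prop]
    obtain ⟨x, hx⟩ : (J₀.val \ J.val).Nonempty := by
      rw [← Finset.card_pos, Finset.card_sdiff_comm hcard.symm]; omega
    rw [Finset.mem_sdiff] at hx hy
    have hxy : x ≠ y := fun h ↦ hx.2 (h ▸ hy.1)
    -- the swapped set `J'`
    set J' : Set.powersetCard (Fin k) q := Set.powersetCard.map q (Equiv.swap x y).toEmbedding J with hJ'
    have hJ'val : J'.val = J.val.map (Equiv.swap x y).toEmbedding := by rw [hJ', Set.powersetCard.val_map]
    have hr' : (J'.val \ J₀.val).card = r := by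
      have hset : J'.val \ J₀.val = (J.val \ J₀.val).erase y := by
        ext i
        rw [hJ'val, Finset.mem_sdiff, Finset.mem_map_equiv, Equiv.symm_swap, Finset.mem_erase, Finset.mem_sdiff]
        by_cases hix : i = x
        · subst hix
          rw [Equiv.swap_apply_left]
          exact ⟨fun h ↦ absurd hx.1 h.2, fun h ↦ absurd h.2.1 hx.2⟩
        by_cases hiy : i = y
        · subst hiy
          rw [Equiv.swap_apply_right]
          exact ⟨fun h ↦ absurd h.1 hx.2, fun h ↦ absurd rfl h.1⟩
        rw [Equiv.swap_apply_of_ne_of_ne hix hiy]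
        exact ⟨fun h ↦ ⟨hiy, h⟩, fun h ↦ h.2⟩
      rw [hset, Finset.card_erase_of_mem (Finset.mem_sdiff.2 hy), hr]
      rfl
    have hz' := ih J' hr'
    -- transport back along the same transposition (an involution)
    have hback : Set.powersetCard.map q (Equiv.swap x y).toEmbedding J' = J := by
      apply Subtype.ext
      rw [Set.powersetCard.val_map, hJ'val, Finset.map_map]
      have : (Equiv.swap x y).toEmbedding.trans (Equiv.swap x y).toEmbedding = Function.Embedding.refl _ :=
        Function.Embedding.ext fun i ↦ Equiv.swap_apply_self x y i
      rw [this, Finset.map_refl]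
    have hJv : J.val = J'.val.map (Equiv.swap x y).toEmbedding := by
      rw [← congrArg Subtype.val hback, Set.powersetCard.val_map]
    have hbackc : Set.powersetCard.map q (Equiv.swap x y).toEmbedding (Set.powersetCard.compl hqk J') =
        Set.powersetCard.compl hqk J := by
      apply Subtype.ext
      rw [Set.powersetCard.val_map, Set.powersetCard.coe_compl, Set.powersetCard.coe_compl, hJv]
      ext i
      simp only [Finset.mem_map_equiv, Finset.mem_compl]
    have h := bilin_natAdd_swap_eq_zero hm hA hd hφ e ha ha0 w E (hS x y hxy) J' (Set.powersetCard.compl hqk J') hz'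
    rwa [hback, hbackc] at h

/-- **Uniqueness of invariant bilinear forms on `⋀^qW^*` (up to a line)**: a bilinear form on `H^q(A(ℂ); ℂ)`
invariant under the exterior action of the torus elements and of the signed transpositions of `SU_H(ℂ)`,
vanishing at ONE complementary pair `(b_{J₀}⁻, b_{J₀ᶜ}⁻)`, vanishes at every pair `(b_J⁻, b_{J'}⁻)` of
`w^*`-monomials (`q + q = k`, `q > 0`). [cite: vanGeemen1994HodgeAV, proof of Thm. 6.12] -/
theorem bilin_natAdd_eq_zero (hqk : q + q = k) (hq : 0 < q)
    (hT : ∀ i₀ i₁ : Fin k, i₀ ≠ i₁ → ∀ x y : complexBetti A.X q,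
      E (extAct (torusAuto hm hA hd hφ e ha ha0 w i₀ i₁ : complexBetti A.X 1 →ₗ[ℂ] complexBetti A.X 1) q x)
        (extAct (torusAuto hm hA hd hφ e ha ha0 w i₀ i₁ : complexBetti A.X 1 →ₗ[ℂ] complexBetti A.X 1) q y) = E x y)
    (hS : ∀ x y : Fin k, x ≠ y → ∀ u v : complexBetti A.X q,
      E (extAct (swapAuto hm hA hd hφ e ha ha0 w x y : complexBetti A.X 1 →ₗ[ℂ] complexBetti A.X 1) q u)
        (extAct (swapAuto hm hA hd hφ e ha ha0 w x y : complexBetti A.X 1 →ₗ[ℂ] complexBetti A.X 1) q v) = E u v)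
    (J₀ J₀' : Set.powersetCard (Fin k) q) (hJ₀ : J₀'.val = J₀.valᶜ)
    (h0 : E (monB (weilBasis hm hA hd hφ e ha ha0 w) q (Set.powersetCard.map q (Fin.natAddEmb k) J₀))
      (monB (weilBasis hm hA hd hφ e ha ha0 w) q (Set.powersetCard.map q (Fin.natAddEmb k) J₀')) = 0)
    (J J' : Set.powersetCard (Fin k) q) :
    E (monB (weilBasis hm hA hd hφ e ha ha0 w) q (Set.powersetCard.map q (Fin.natAddEmb k) J))
      (monB (weilBasis hm hA hd hφ e ha ha0 w) q (Set.powersetCard.map q (Fin.natAddEmb k) J')) = 0 := by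
  classical
  by_cases hJ : J'.val = J.valᶜ
  · have hqk' : q + q = Fintype.card (Fin k) := by rw [Fintype.card_fin]; exact hqk
    have hJ' : J' = Set.powersetCard.compl hqk' J := Subtype.ext (by rw [Set.powersetCard.coe_compl]; exact hJ)
    have hJ₀' : J₀' = Set.powersetCard.compl hqk' J₀ := Subtype.ext (by rw [Set.powersetCard.coe_compl]; exact hJ₀)
    rw [hJ']
    rw [hJ₀'] at h0
    exact bilin_natAdd_compl_eq_zero_of_eq_zero hm hA hd hφ e ha ha0 w E hqk' hS J₀ h0 J
  · exact bilin_natAdd_eq_zero_of_ne_compl hm hA hd hφ e ha ha0 w E hqk hq hT J J' hJ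

/-- **Bilinear extension**: under the hypotheses of `bilin_natAdd_eq_zero`, `E` vanishes on the span of the
`w^*`-monomials in both arguments (for an eightfold in degree `4`: on `⋀⁴W^* × ⋀⁴W^*`, by
`weilClassesMinus_two_le_span`). [cite: vanGeemen1994HodgeAV, proof of Thm. 6.12] -/
theorem bilin_eq_zero_of_mem_span_natAdd
    (hE : ∀ J J' : Set.powersetCard (Fin k) q,
      E (monB (weilBasis hm hA hd hφ e ha ha0 w) q (Set.powersetCard.map q (Fin.natAddEmb k) J))
        (monB (weilBasis hm hA hd hφ e ha ha0 w) q (Set.powersetCard.map q (Fin.natAddEmb k) J')) = 0)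
    {u v : complexBetti A.X q}
    (hu : u ∈ Submodule.span ℂ (Set.range fun J : Set.powersetCard (Fin k) q ↦
      monB (weilBasis hm hA hd hφ e ha ha0 w) q (Set.powersetCard.map q (Fin.natAddEmb k) J)))
    (hv : v ∈ Submodule.span ℂ (Set.range fun J : Set.powersetCard (Fin k) q ↦
      monB (weilBasis hm hA hd hφ e ha ha0 w) q (Set.powersetCard.map q (Fin.natAddEmb k) J))) :
    E u v = 0 := by
  induction hv using Submodule.span_induction with
  | mem v' hv' =>
    obtain ⟨J', rfl⟩ := hv'
    induction hu using Submodule.span_induction with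
    | mem u' hu' =>
      obtain ⟨J, rfl⟩ := hu'
      exact hE J J'
    | zero => rw [LinearMap.map_zero₂]
    | add u₁ u₂ _ _ h₁ h₂ => rw [LinearMap.map_add₂, h₁, h₂, add_zero]
    | smul c u₁ _ h₁ => rw [LinearMap.map_smul₂, h₁, smul_zero]
  | zero => rw [map_zero]
  | add v₁ v₂ _ _ h₁ h₂ => rw [map_add, h₁, h₂, add_zero]
  | smul c v₁ _ h₁ => rw [map_smul, h₁, smul_zero]

end Invariant

end Summit.HodgeConjecture.HodgeConjecture.Theorems.CYFormSquare

end
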